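import Summits.HodgeConjecture.CorCM.HypDel.ExtAmbientReceptacleQArchB
import Literature.AlgebraicGeometry.ShimuraVarieties.UnitaryAuxiliarySpecialPair
import Literature.AlgebraicGeometry.ShimuraVarieties.UnitaryOrthogonalFrame
import Literature.AlgebraicGeometry.ShimuraVarieties.UnitaryShimuraReciprocityTwistInvariance
import Literature.NumberTheory.Automorphic.UnitaryGroupFrameHermitian
import HarnessLib

/-!
# T3 v4 `stub_S4 : QArch.S4Push` — Siegel reciprocity pushed down along `Ψ`, at the special pair of a line

Cell hodgecm-mathlib, fan B-III (T3), crux `HDel` (item stmt-HodgeConjecture-24835), B-plan2's line `F1ExtHodgeType` v4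
«Q-ARCHITECTURE», registered stub `stub_S4 : Summit.HodgeConjecture.CorCM.HypDel.ExtReceptacle.QArch.S4Push` (★ τ0-v4
`ExtAmbientReceptacleQArchB` :76; owner A-p04).  TARGET: from the canonicity of the Siegel `ℚ`-structure (★ (σ4)-D
`SiegelRationalModel.IsCanonical`: reciprocity (62) at ALL CM special pairs), the point formula `PointFormulaK` of the receptacle
`(A, ι, Ψ)` and the Galois intertwining `GaloisIntertwines`, deduce `ReciprocityThrough M Φ E hE L₀ Sc K A ι`: for `σ ∈ Aut(ℂ/E)`,
`art_E(s) = σ|`, a line point `x` of `L·v₃`, the diagonal twist `d` by `r_x(N_{E/τL} s)` and `t = N_{E,Φ}(s)`: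
`σ • ι([x, aK], p) = ι([x, d·aK], t·p)`.

PROOF ([Deligne1971TravauxShimura] 5.11–5.12 «le point spécial de la droite»; [Milne2005ShimuraVarieties] Def. 12.5–12.8, Ex. 12.4 (b)):
the point `[J_{β,Φ}(x), ũ_β(a, t_p)]` of the Siegel variety is SPECIAL for the CM algebra `F = M^{1⊕3}` acting diagonally in an
`H`-orthogonal `L`-frame `b = (v₁|v₂|v₃)` through the line (★ `exists_orthogonalFrame`; CM structure ★ `exists_cmStructure_of_orthogonal`
of `B = b^j`; special pair ★ `isSpecial_of_frame_spec_of_line` with CM types `(Φ; Φ, Φ, Φ^τ̄)`, ★ `exists_cmType_swap`; reflex fields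
in `E` by ★ `traceField_le_of_swap`), and the reciprocity element of (62) at this pair IS the matrix of `ũ_β(d, t)` (★ B-p16
`coe_auxToGspFin_eq_cmRecipMatrix` with ★ `actMatrix_eq_frame_of_pinned`) and the idèle identity
`N_{E,Φ^τ̄}(s) = N_{E,Φ}(s) · (r_x(N_{E/L} s))^j` ([Milne2005ShimuraVarieties] (60)–(61), `μ_x = [τ̄] − [τ]`; ★ B-p16
`reflexNormFiniteIdele_swap_recipFactor` over ★ `ReflexNormSwap`).  Then `IsCanonical` gives
`σ[J_x, ũ(a,t_p)] = [J_x, ũ(d,t)·ũ(a,t_p)] = [J_x, ũ(d·a, t·t_p)]`, and `PointFormulaK` + `GaloisIntertwines` transport it to `A`.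
MAIN: `stub_S4 : QArch.S4Push` (hypothesis-free; the registered stub's short name and signature).  HC_CM is proved only modulo the
7 printed citations until rung 0 closes; this file retires the registered stub `stub_S4` of the workfile and changes no floor count.
[cite: Deligne1971TravauxShimura, 4.18 p. 150, 5.11 p. 158, Thm. 4.21 p. 152] [cite: Milne2005ShimuraVarieties, Def. 12.5, Rem. 12.6 p. 113, Def. 12.8 (60)–(62) p. 114, Ex. 12.4 (b) p. 112]
[cite: Shimura1998, §18.6 Thm. 18.6 p. 127]
-/

set_option linter.dupNamespace false

noncomputable section

namespace Summit.HodgeConjecture.HodgeConjecture.Theorems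

open Function MulAction NumberField IsDedekindDomain CategoryTheory Matrix
open Literature.AlgebraicGeometry Literature.AlgebraicGeometry.Motives
open Literature.NumberTheory.Automorphic Literature.NumberTheory.Automorphic.UnitaryGroup
open Literature.NumberTheory.Automorphic.Liu2021.AppendixC (C5.OpenCompactSubgroup C5.SmallLevel)
open Literature.Geometry.ComplexHyperbolic Literature.Geometry.ComplexHyperbolic.BallModel
open Literature.AlgebraicGeometry.ShimuraVarieties Literature.AlgebraicGeometry.ShimuraVarieties.UnitaryCanonicalModel
open Literature.AlgebraicGeometry.ShimuraVarieties.UnitaryCanonicalModel.Aux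
open Literature.AlgebraicGeometry.ModuliOfAbelianVarieties
open Literature.NumberTheory.ComplexMultiplication (traceField reflexNormFiniteIdele ratFiniteAdeleTensorEquiv)
open Literature.NumberTheory.AdelicBaseChange (finiteIdeleRelNorm)
open Summit.HodgeConjecture.CorCM.HypDel.ExtReceptacle
open Summit.HodgeConjecture.CorCM.HypDel.ExtReceptacle.QArch

/-- The Gram entries of the base-changed frame `b^j`: `(ᵗc_M(b^j)·H^j·b^j)_{kl} = j(⟨b e_k, b e_l⟩_H)` (an embedding of CM fields
commutes with the complex conjugations, ★ `ringHom_complexConj`). [cite: Deligne1979ShimuraVarieties, 2.3.9 (PDF p. 32)] -/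
theorem transpose_map_complexConj_map_mul_mul_apply {L : Type} [Field L] [NumberField L] [IsCMField L]
    {M : Type} [Field M] [NumberField M] [IsCMField M] (j : L →+* M) (H b : Matrix (Fin 3) (Fin 3) L) (k l : Fin 3) :
    (((b.map j).map (IsCMField.complexConj M))ᵀ * H.map j * b.map j) k l =
      j (hermForm (cmConjRingHom L) H (fun i => b i k) (fun i => b i l)) := by
  simp only [Matrix.mul_apply, Matrix.transpose_apply, Matrix.map_apply, hermForm, dotProduct, Matrix.mulVec,
    Function.comp_apply, map_sum, map_mul, cmConjRingHom_apply, ringHom_complexConj M j, Finset.sum_mul,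
    Finset.mul_sum, mul_assoc]
  rw [Finset.sum_comm]

/-- **`stub_S4` of the T3 v4 line `F1ExtHodgeType` (item stmt-HodgeConjecture-24835): Siegel reciprocity pushed down along `Ψ`.**
For every hDel datum, receptacle `(A, ι, Ψ)` with the point formula `PointFormulaK` and the Galois intertwining `GaloisIntertwines`
over a CANONICAL Siegel `ℚ`-structure `R` (★ `SiegelRationalModel.IsCanonical`), the reciprocity law (62) holds through `ι` at the
special points of every line `L·v₃` (`ReciprocityThrough`): `σ • ι([x, aK], p) = ι([x, d·aK], N_{E,Φ}(s)·p)`.  The special pair is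
that of the `H`-orthogonal frame through `v₃` with CM types `(Φ; Φ, Φ, Φ^τ̄)`; the reciprocity element is `ũ_β(d, N_{E,Φ}(s))` by
★ `coe_auxToGspFin_eq_cmRecipMatrix` and the reflex-norm swap ★ `reflexNormFiniteIdele_swap_recipFactor`
([Milne2005ShimuraVarieties] (60)–(62) with `μ_x = [τ̄] − [τ]`). [cite: Deligne1971TravauxShimura, 5.11 p. 158, Thm. 4.21 p. 152]
[cite: Milne2005ShimuraVarieties, Def. 12.8 (60)–(62) p. 114, Ex. 12.4 (b) p. 112] [cite: Shimura1998, §18.6 Thm. 18.6 p. 127] -/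
theorem stub_S4 : QArch.S4Push := by
  intro L _ _ _ H τ T hT hpos hanis K₀ hK₀ Sc M _ _ _ j Φ hΦ E _ hE hΦE L₀ K ξ₀ ξ g δ F hξ hg hδ hJ hKL Sg R hR KN A ι
    Ψm hPF hGI σ s hσs v₃ x hx d hd t ht a p
  haveI : NumberField ↥E := NumberField.mk
  letI : Algebra L ↥E := (toFieldOfMem τ E hE).toAlgebra
  -- (1) the hermitian datum and the orthogonal frame through `v₃`
  have hH : ∀ i k, cmConjRingHom L (H i k) = H k i := cmConjRingHom_apply_eq_of_formCongr_eq_J L H τ T hT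
  have hq : hermForm (cmConjRingHom L) H v₃ v₃ ≠ 0 := hermForm_self_ne_zero_of_isLinePoint L H τ T hT hx
  have hv₃ : v₃ ≠ 0 := by
    intro h
    apply hq
    rw [h]
    simp [hermForm]
  obtain ⟨b, hb3, hborth⟩ := exists_orthogonalFrame H hH hanis v₃ hv₃
  have hcol3 : (fun i => (b : Matrix (Fin 3) (Fin 3) L) i 2) = v₃ := funext hb3
  set B : GL (Fin 3) M := Matrix.GeneralLinearGroup.map (j : L →+* M) b with hBdef
  have hBval : (B : Matrix (Fin 3) (Fin 3) M) = (b : Matrix (Fin 3) (Fin 3) L).map j := rfl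
  have hB : ∀ k l : Fin 3, k ≠ l →
      (((B : Matrix (Fin 3) (Fin 3) M).map (IsCMField.complexConj M))ᵀ * H.map j *
        (B : Matrix (Fin 3) (Fin 3) M)) k l = 0 := by
    intro k l hkl
    rw [hBval, transpose_map_complexConj_map_mul_mul_apply j H _ k l, hborth k l hkl, map_zero]
  -- (2) the CM structure of the frame and its special pair
  obtain ⟨c, hc⟩ := exists_cmStructure_of_orthogonal F B hB
  have hτ : ComplexEmbedding.conjugate τ ≠ τ := fun h =>
    IsTotallyComplex.complexEmbedding_not_isReal τ (ComplexEmbedding.isReal_iff.mpr h)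
  obtain ⟨Ψ, hΨ⟩ := exists_cmType_swap Φ τ j hτ
  let Φ' : Fin 1 ⊕ Fin 3 → CMType M := fun q => if q = Sum.inr 2 then Ψ else Φ
  have hΦ'₁ : ∀ q, q ≠ Sum.inr 2 → Φ' q = Φ := fun q hq' => if_neg hq'
  have hΦ'₃ : Φ' (Sum.inr 2) = Ψ := if_pos rfl
  have hΦ'₂ : ∀ ρ : M →+* ℂ, ρ ∈ (Φ' (Sum.inr 2)).1 ↔
      (ρ ∈ Φ.1 ∧ ρ.comp j ≠ τ) ∨ ρ.comp j = ComplexEmbedding.conjugate τ := fun ρ => by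
    rw [hΦ'₃]; exact hΨ ρ
  have hline : ∀ ρ : Φ.1, ρ.1.comp j = τ → ∃ c₀ : ℂ, c₀ ≠ 0 ∧
      (T : Matrix (Fin 3) (Fin 3) ℂ) *ᵥ BallModel.lift x = c₀ • fun i => ρ.1 ((B : Matrix (Fin 3) (Fin 3) M) i 2) := by
    intro ρ hρ
    obtain ⟨c₀, hc₀, hTx⟩ := hx
    refine ⟨c₀, hc₀, ?_⟩
    rw [hTx]
    congr 1
    funext i
    rw [hBval, Matrix.map_apply, hb3 i, ← RingHom.comp_apply ρ.1 j, hρ]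
  have hspec := isSpecial_of_frame_spec_of_line F τ Φ T hT hτ x B hB hline c hc
    ⟨auxComplexStructure F τ Φ T x, hJ x⟩ rfl Φ' hΦ'₁ hΦ'₂
  have htrace : ∀ q, traceField (Φ' q) ≤ E := by
    intro q
    by_cases hq' : q = Sum.inr 2
    · rw [hq', hΦ'₃]
      exact traceField_le_of_swap Φ Ψ τ j hΨ E hE hΦE
    · rw [hΦ'₁ q hq']
      exact hΦE
  -- (3) the reciprocity element `ũ(d, t)` is the matrix of (62) at the special pair
  have h0 := hborth 0 2 (by decide)
  have h1 := hborth 1 2 (by decide)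
  have hd' : IsDiagTwist L H (fun i => (b : Matrix (Fin 3) (Fin 3) L) i 2)
      (recipFactor L (finiteIdeleRelNorm L ↥E s)) d := by
    rw [hcol3]; exact hd
  have hN : ∀ q : Fin 1 ⊕ Fin 3, q ≠ Sum.inr 2 →
      ((reflexNormFiniteIdele M (Φ' q) E s : (FiniteAdeleRing (𝓞 M) M)ˣ) : FiniteAdeleRing (𝓞 M) M) =
        ((t : (FiniteAdeleRing (𝓞 M) M)ˣ) : FiniteAdeleRing (𝓞 M) M) := by
    intro q hq'
    rw [hΦ'₁ q hq', ← ht]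
  have hτE : ∀ y : L, ((algebraMap L ↥E y : ↥E) : ℂ) = τ y := fun _ => rfl
  have hΨE : traceField Ψ ≤ E := traceField_le_of_swap Φ Ψ τ j hΨ E hE hΦE
  have hN₂ : ((reflexNormFiniteIdele M (Φ' (Sum.inr 2)) E s : (FiniteAdeleRing (𝓞 M) M)ˣ) :
        FiniteAdeleRing (𝓞 M) M) =
      ((t : (FiniteAdeleRing (𝓞 M) M)ˣ) : FiniteAdeleRing (𝓞 M) M) *
        ratFiniteAdeleTensorEquiv M (finAdeleToTensor M j (recipFactor L (finiteIdeleRelNorm L ↥E s))) := by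
    rw [hΦ'₃, reflexNormFiniteIdele_swap_recipFactor M j Φ Ψ E τ hτE hΦE hΨE hΦ hΨ s, ← ht]
  have hr := coe_auxToGspFin_eq_cmRecipMatrix F b h0 h1 c (actMatrix_eq_frame_of_pinned F B c hc)
    (recipFactor L (finiteIdeleRelNorm L ↥E s)) d hd' t Φ' E s hN hN₂
  -- (4) (62) on the Siegel side, transported along `Ψ`
  obtain ⟨t_p, htp⟩ : ∃ t_p : ↥(torusFinAdelic M), classOf M L₀ t_p = p := QuotientGroup.mk'_surjective _ p
  have hcan := hR (Fin 1 ⊕ Fin 3) (fun _ => M) c ⟨auxComplexStructure F τ Φ T x, hJ x⟩ Φ' hspec E htrace σ s hσs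
    (auxToGspFin F (d, t)) hr KN (auxToGspFin F (a, t_p))
  rw [← map_mul, Prod.mk_mul_mk] at hcan
  have hP := hPF p x a t_p htp
  have hP' := hPF (classOf M L₀ t * p) x (d * a) (t * t_p) (by rw [map_mul, htp])
  rw [hP, hP']
  exact hGI σ _ _ hcan.symm

end Summit.HodgeConjecture.HodgeConjecture.Theorems

end
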